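import Summits.HodgeConjecture.HodgeConjecture.Theorems.H413HolRealOfTransport
import Summits.HodgeConjecture.HodgeConjecture.Theorems.H413FinRepZeroTransportLaws
import Summits.HodgeConjecture.CorCM.B01.Transposition.Item6OmegaChiSplitting
import Literature.NumberTheory.Automorphic.Liu2021.Def411WeilCarriersAtLine
import Summits.HodgeConjecture.HodgeCM.Model.LiuDictionaryPin
import HarnessLib

/-!
# FLOOR-0 P4, seat S4′(i) ∕ S4b — THE REDUCTION THEOREM: a holomorphic, `U(V)(𝔸_f)`-equivariant, non-zero `θ` on [Liu2021, Def. 4.11]'s carrier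
# AT THE LINE `⟨a⟩`, from named inputs (junction `Ψ`, knob equation, `(χ)`-row, archimedean inputs, non-vanishing)

Cell hodgecm-mathlib (D-0151), FLOOR 0, crux item H413 = stmt-HodgeConjecture-24833; P4 line (ed. 2) `Cruxes/H413/Lines/F0_P4AdmissibleOccursInH1.lean`,
stub S4b `stub_T3a_holThetaAtAdmissibleLineOfRallisAt`.  Author F0P4-p01 (g0) (seat (i)); SEAT-i MEMO v3 §S4b.  `--supports stmt-HodgeConjecture-24833 --as helper`.
DEF-FREE.  HC_CM is proved only modulo the printed citations until rung 0 closes.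

**`exists_holTheta_atLine_of_inputs`** — the conclusion is LITERALLY the `∃ θ`-clause of S4b (for arbitrary `(κ, a, χ)` in place of
`(toHeckeCharacter t.μ, a, t.χ)`): `∃ θ : omegaAtLine[e₁, frameD V, hsChiD κ] a χ →ₗ[ℂ] (U(V)(𝔸) → ℂ²)`, `θ ≠ 0`, values in `holCotForms (archFactorOf F V)`,
`θ (rhoVAtLine … (ιVE V g) w) = rightRep F V g (θ w)`.  It is ★ `exists_holReal_of_transport_sideAt` (p793201) at the model datum ★ `ThetaDistAtLine.distDatumAt`
(slot `0` of the diagonal see-saw context at a real `a₀ ≠ 0`), with the transport `T := finSBReindex e₁` and its two laws DISCHARGED by ★ p793257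
`finRepZero_inr_finSBReindex` ∕ `finRepZero_inl_finSBReindex` (+ the read-back `distDatumAt_ωf`), the `U(V)(𝔸_f)`-scalars cancelled by the KNOB EQUATION `hknob`.
What remains as NAMED INPUTS (each owned, see the memo): the junction `(Ψ, λ, χ₁)` — PRODUCED by ★ p796716 `exists_coinv_equiv_TW_splittingOf` at `a₀ := ↑a`,
`χW := lineChar a χ.1`, `h := compat_line₀ …` (`λ g := χtw (ιVE V g, 1)`); the knob equation `finCharZero (etaT₀ η ν) (g,1) = λ g` (solved for `ν`, ★ p793327
`finCharZero_etaT₀_eq_iff` ∕ `exists_character_extend_finPart`); the `(χ)`-row `D.chiFin χ̃ u = finCharZero (1,u) · χ₁ u` (F0P4-p02 ∕ p05); the archimedean ∕ analytic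
inputs `A, Φarch, harm, hdef, hLF, hd, hCR` of the datum; and the non-vanishing `∃ Φf, D.dist χ̃⁻¹ Φf ≠ 0` (seat (ii): Rallis).

## References
* [Liu2021] Y. Liu, Camb. J. Math. 9 (2021): Def. 4.11 (l. 2092–2096); proof of Prop. 4.13 (l. 2145); App. D §D.1 Steps 1–3 (l. 5217–5221).
* [GelbartRogawski1991] S. Gelbart, J. Rogawski, Invent. Math. 105 (1991), §3.1 Prop. 3.1.1 p. 455; Remark p. 457 L4–13.
* Tree: ★ `Theorems/H413HolRealOfTransport`, ★ `Theorems/H413FinRepZeroTransportLaws`, ★ `Theorems/H413ThetaDistAtLine`, ★ `Def411WeilCarriersAtLine`.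
-/

set_option autoImplicit false
set_option linter.dupNamespace false

noncomputable section

open MulAction NumberField NumberField.mixedEmbedding IsDedekindDomain
open scoped SchwartzMap TensorProduct Classical Matrix
open Literature.NumberTheory.Automorphic Literature.NumberTheory.Automorphic.UnitaryGroup Literature.NumberTheory.Weil1964
open Literature.Geometry.ComplexHyperbolic.BallModel (U21 x₀)
open Literature.AlgebraicGeometry.ShimuraVarieties
open Literature.AlgebraicGeometry.Motives (CMType)
open Literature.NumberTheory.GelbartRogawski1991 Literature.NumberTheory.GelbartRogawski1991.UnitaryDualPair
open Literature.NumberTheory.GelbartRogawski1991.UnitaryDualPair.WeilCoinv (commute_comp_inl_comp_inr)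
open Literature.NumberTheory.Automorphic.Liu2021.Def411WeilCarriers (omegaAtLine rhoVAtLine Chi)
open Literature.NumberTheory.GaloisRepresentations (HeckeCharacter)
open Literature.RepresentationTheory.HarrisKudlaSweet1996 (IsSplittingChar)
open HodgeCM HodgeCM.Adelic HodgeCM.PerL34 HodgeCM.Model HodgeCM.Model.ThetaSpace HodgeCM.Model.ArchSideTerm HodgeCM.Model.ThetaAdelicSide
open HodgeCM.Model.ThetaDistFin
open HodgeCM.Model.SupplyResidual.WeilPairData (charInv)
open Summit.HodgeConjecture.CorCM.Transposition.OmegaChiSplitting (hsChiD)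
open Summit.HodgeConjecture.HodgeConjecture.Cruxes.H413.CohFormsCarriers
open Summit.HodgeConjecture.HodgeConjecture.Cruxes.H413.CuspCot
open Summit.HodgeConjecture.HodgeConjecture.Cruxes.H413.ThetaDistAtLine

namespace Summit.HodgeConjecture.HodgeConjecture.Cruxes.H413.ThetaJunction

variable (F : HodgeCM.CMField) {ι₁ : F →+* ℂ} (V : HodgeCM.HermSpace3 F ι₁) (hV : IsAnisotropic F (HodgeCM.HermSpace3.Hm V))

/-! ## The model datum at the line `a₀` (slot `0` of the diagonal context) and its inputs -/

variable (Φ : CMType (F : Type)) (σ : (F : Type) →+* ℂ) (a : (F : Type)) (ha : IsCMField.complexConj (F : Type) a = a) (ha0 : a ≠ 0)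
variable (η : CMAdelic (F : Type) (frameD V) × CMAdelic (F : Type) (dW (cDiag Φ σ a ha ha0).D) →* ℂˣ)
  (hη : ∀ γU ∈ CMRat (F : Type) (frameD V), ∀ γ ∈ CMRat (F : Type) (dW (cDiag Φ σ a ha ha0).D), η (γU, γ) = 1)
  (hηc : Continuous fun p => ((η p : ℂˣ) : ℂ))
  (ν : CMAdelic (F : Type) (frameD V) →* ℂˣ)
  (hν : ∀ γU ∈ CMRat (F : Type) (frameD V), ν γU = 1)
  (hνc : Continuous fun v => ((ν v : ℂˣ) : ℂ))
  (A : ∀ k : Fin 4, ArchLineInput V (lineRepT V (cDiag Φ σ a ha ha0).D (compat_plane V Φ σ a ha ha0) (compat_line₀ V Φ σ a ha ha0)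
    (compat_line₁ V Φ σ a ha ha0) (compat_line₂ V Φ σ a ha ha0) (compat_line₃ V Φ σ a ha ha0) η ν k))
variable (Φarch : Module.Dual ℂ (Fin 2 → ℂ) →ₗ[ℂ] 𝓢((Fin 3 → mixedSpace (↥(maximalRealSubfield F))), ℂ))
  (harm : ∀ (u : ↥(stabilizer U21 x₀)) (ℓ : Module.Dual ℂ (Fin 2 → ℂ)),
    lineOmega_zero V (cDiag Φ σ a ha ha0).D (compat_plane V Φ σ a ha ha0) (compat_line₀ V Φ σ a ha ha0) (compat_line₁ V Φ σ a ha ha0)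
        (etaT₀ V (cDiag Φ σ a ha ha0).D η ν) (u : U21) (Φarch ℓ) =
      Φarch ((BallForms.isPullbackCocycle_cotangentCocycle.weightOf x₀).dual u ℓ))
  (hdef : ∀ g : UnitaryGroup.arch (↥(maximalRealSubfield F)) F (IsCMField.complexConj F) 3 V.Hm,
    UnitaryGroup.archAt (↥(maximalRealSubfield F)) F (IsCMField.complexConj F) 3 V.Hm (UnitaryGroup.cmPlace (F : Type) ι₁)
        (NumberField.complexConj_smul_infinitePlace (F : Type) _) (IsCMField.complexConj_ne_one (F : Type)) g = 1 →
    ∀ (ℓ : Module.Dual ℂ (Fin 2 → ℂ)) (Φf : FinSB (↥(maximalRealSubfield F)) (Fin 3)),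
      lineRepOf V (cDiag Φ σ a ha ha0).D (compat_plane V Φ σ a ha ha0) (compat_line₀ V Φ σ a ha ha0) (compat_line₁ V Φ σ a ha ha0)
          (compat_line₂ V Φ σ a ha ha0) (compat_line₃ V Φ σ a ha ha0) (etaT₀ V (cDiag Φ σ a ha ha0).D η ν)
          (etaT₁ V (cDiag Φ σ a ha ha0).D η ν) (eta₂ V (cDiag Φ σ a ha ha0).D η) (eta₃ V (cDiag Φ σ a ha ha0).D η) 0
          (HodgeCM.Adelic.regimeEquiv F V.Hm hV
            (UnitaryGroup.archToAdelic (↥(maximalRealSubfield F)) F (IsCMField.complexConj F) 3 V.Hm g), 1)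
          (piSchwartzBruhatEquiv (↥(maximalRealSubfield F)) (Fin 3) (Φarch ℓ ⊗ₜ[ℂ] Φf)) =
        piSchwartzBruhatEquiv (↥(maximalRealSubfield F)) (Fin 3) (Φarch ℓ ⊗ₜ[ℂ] Φf))

  (hLF : ((sideAt V Φ σ a ha ha0 η hη hηc ν hν hνc A).P 0).IsLFAction)
  (hd : ∀ (T : 𝓢((Fin 3 → mixedSpace (↥(maximalRealSubfield F))), ℂ) →L[ℂ] ℂ) (ℓ : Module.Dual ℂ (Fin 2 → ℂ)),
    DifferentiableAt ℝ (fun b => T ((distDatumAt V Φ σ a ha ha0 η hη hηc ν hν hνc A hV Φarch harm hdef).ωA (BallForms.expP b)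
      ((distDatumAt V Φ σ a ha ha0 η hη hηc ν hν hνc A hV Φarch harm hdef).Φarch ℓ))) 0)
  (hCR : ∀ (T : 𝓢((Fin 3 → mixedSpace (↥(maximalRealSubfield F))), ℂ) →L[ℂ] ℂ) (ℓ : Module.Dual ℂ (Fin 2 → ℂ)) (v : Fin 2 → ℂ),
    fderiv ℝ (fun b => T ((distDatumAt V Φ σ a ha ha0 η hη hηc ν hν hνc A hV Φarch harm hdef).ωA (BallForms.expP b)
      ((distDatumAt V Φ σ a ha ha0 η hη hηc ν hν hνc A hV Φarch harm hdef).Φarch ℓ))) 0 (Complex.I • v) =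
      Complex.I • fderiv ℝ (fun b => T ((distDatumAt V Φ σ a ha ha0 η hη hηc ν hν hνc A hV Φarch harm hdef).ωA (BallForms.expP b)
        ((distDatumAt V Φ σ a ha ha0 η hη hηc ν hν hνc A hV Φarch harm hdef).Φarch ℓ))) 0 v)

/-! ## The pin carrier at the line `⟨a⟩` and the junction inputs -/

variable (κ : HeckeCharacter (F : Type)) (hκu : κ.IsUnitary) (hκs : IsSplittingChar (F : Type) 1 κ)
  (aU : (↥(maximalRealSubfield (F : Type)))ˣ) (χ : Chi ↥(maximalRealSubfield (F : Type)) (F : Type) (IsCMField.complexConj (F : Type)))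
  (χM : PontryaginDual (↥(Literature.NumberTheory.Automorphic.relNormOneIdeles (↥(maximalRealSubfield F)) F) ⧸
      Literature.NumberTheory.Automorphic.relNormOneRat (↥(maximalRealSubfield F)) F))
  (χ₁ : UfZero (cDiag Φ σ a ha ha0).D →* ℂˣ) (lam : ↥(HodgeCM.HermSpace3.adelicFin V) → ℂˣ)
  (Ψ : omegaAtLine ↥(maximalRealSubfield (F : Type)) (F : Type) (IsCMField.complexConj (F : Type)) 3 e₁
        (Matrix.diagonal (frameD V)) (complexConj_imagUnit (F : Type)) (imagUnit_ne_zero (F : Type)) (imagUnit_mul_self (F : Type))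
        (realDiagonal_isSymm (F : Type) (frameD V) (frameD_real V)) (isUnit_det_realDiagonal (F : Type) (frameD V) (frameD_real V) (frameD_ne V))
        (realDiagonal_map (F : Type) (frameD V) (frameD_real V)).symm
        (hsChiD (⟨HodgeCM.CMField.K F⟩ : Summit.HodgeConjecture.CorCM.CMField) e₁ (frameD V) (frameD_real V) (frameD_ne V) κ hκu hκs) aU χ ≃ₗ[ℂ]
    Literature.RepresentationTheory.TwistedCoinv.Coinv
      ((UnitaryDualPair.WeilCoinv.finPairRep _ _ _ _ _ _ _ _ _ _ _ _ _ _ _ _ _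
          (splittingOf_isCompatible _ _ _ _ _ _ _ _ _ _ _ _ _ _ _ _ _ (compat_line₀ V Φ σ a ha ha0))).comp (MonoidHom.inr _ _)) χ₁)
  (hΨ : ∀ (g : ↥(HodgeCM.HermSpace3.adelicFin V)) (x : omegaAtLine ↥(maximalRealSubfield (F : Type)) (F : Type) (IsCMField.complexConj (F : Type)) 3 e₁
        (Matrix.diagonal (frameD V)) (complexConj_imagUnit (F : Type)) (imagUnit_ne_zero (F : Type)) (imagUnit_mul_self (F : Type))
        (realDiagonal_isSymm (F : Type) (frameD V) (frameD_real V)) (isUnit_det_realDiagonal (F : Type) (frameD V) (frameD_real V) (frameD_ne V))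
        (realDiagonal_map (F : Type) (frameD V) (frameD_real V)).symm
        (hsChiD (⟨HodgeCM.CMField.K F⟩ : Summit.HodgeConjecture.CorCM.CMField) e₁ (frameD V) (frameD_real V) (frameD_ne V) κ hκu hκs) aU χ),
    Ψ (rhoVAtLine ↥(maximalRealSubfield (F : Type)) (F : Type) (IsCMField.complexConj (F : Type)) 3 e₁
        (Matrix.diagonal (frameD V)) (complexConj_imagUnit (F : Type)) (imagUnit_ne_zero (F : Type)) (imagUnit_mul_self (F : Type))
        (realDiagonal_isSymm (F : Type) (frameD V) (frameD_real V)) (isUnit_det_realDiagonal (F : Type) (frameD V) (frameD_real V) (frameD_ne V))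
        (realDiagonal_map (F : Type) (frameD V) (frameD_real V)).symm
        (hsChiD (⟨HodgeCM.CMField.K F⟩ : Summit.HodgeConjecture.CorCM.CMField) e₁ (frameD V) (frameD_real V) (frameD_ne V) κ hκu hκs) aU χ (ιVE V g) x) =
      ((lam g : ℂˣ) : ℂ) •
        Literature.RepresentationTheory.TwistedCoinv.rep χ₁
          ((UnitaryDualPair.WeilCoinv.finPairRep _ _ _ _ _ _ _ _ _ _ _ _ _ _ _ _ _
          (splittingOf_isCompatible _ _ _ _ _ _ _ _ _ _ _ _ _ _ _ _ _ (compat_line₀ V Φ σ a ha ha0))).comp (MonoidHom.inl _ _))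
          (commute_comp_inl_comp_inr _) (ιVE V g) (Ψ x))
  (hknob : ∀ g : ↥(HodgeCM.HermSpace3.adelicFin V),
    finCharZero V (cDiag Φ σ a ha ha0).D (compat_plane V Φ σ a ha ha0) (compat_line₀ V Φ σ a ha ha0) (compat_line₁ V Φ σ a ha ha0) (etaT₀ V (cDiag Φ σ a ha ha0).D η ν) (g, 1) = lam g)
  (hχ : ∀ u : UfZero (cDiag Φ σ a ha ha0).D,
    (distDatumAt V Φ σ a ha ha0 η hη hηc ν hν hνc A hV Φarch harm hdef).chiFin χM u =
      finCharZero V (cDiag Φ σ a ha ha0).D (compat_plane V Φ σ a ha ha0) (compat_line₀ V Φ σ a ha ha0) (compat_line₁ V Φ σ a ha ha0) (etaT₀ V (cDiag Φ σ a ha ha0).D η ν) (1, u) * χ₁ u)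
  (hne : ∃ Φf : FinSB (↥(maximalRealSubfield F)) (Fin 3), (distDatumAt V Φ σ a ha ha0 η hη hηc ν hν hνc A hV Φarch harm hdef).dist (charInv χM) Φf ≠ 0)

include hLF hd hCR hΨ hknob hχ hne in
set_option maxHeartbeats 4000000 in
/-- **THE S4b REDUCTION THEOREM** — see the module docstring: the `∃ θ`-clause of `StubT3aHolThetaAtAdmissibleLineOfRallisAt` at `(κ, a, χ)` from the junction
`(Ψ, λ, χ₁)`, the knob equation, the `(χ)`-row, the archimedean ∕ analytic inputs of the model datum at `a₀`, and the non-vanishing of the `χ̃`-component.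
[cite: Liu2021, proof of Prop. 4.13 (l. 2145); App. D §D.1 Steps 1–3 (l. 5217–5221)] [cite: GelbartRogawski1991, §3.1 Prop. 3.1.1 p. 455; Remark p. 457 L4–13] -/
theorem exists_holTheta_atLine_of_inputs :
    ∃ θ : omegaAtLine ↥(maximalRealSubfield (F : Type)) (F : Type) (IsCMField.complexConj (F : Type)) 3 e₁
        (Matrix.diagonal (frameD V)) (complexConj_imagUnit (F : Type)) (imagUnit_ne_zero (F : Type)) (imagUnit_mul_self (F : Type))
        (realDiagonal_isSymm (F : Type) (frameD V) (frameD_real V)) (isUnit_det_realDiagonal (F : Type) (frameD V) (frameD_real V) (frameD_ne V))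
        (realDiagonal_map (F : Type) (frameD V) (frameD_real V)).symm
        (hsChiD (⟨HodgeCM.CMField.K F⟩ : Summit.HodgeConjecture.CorCM.CMField) e₁ (frameD V) (frameD_real V) (frameD_ne V) κ hκu hκs) aU χ →ₗ[ℂ] ((adelicDatum F V).Adelic → (Fin 2 → ℂ)),
      θ ≠ 0 ∧ (∀ w, θ w ∈ holCotForms (archFactorOf F V)) ∧
        ∀ (g : ↥(HodgeCM.HermSpace3.adelicFin V)) (w : omegaAtLine ↥(maximalRealSubfield (F : Type)) (F : Type) (IsCMField.complexConj (F : Type)) 3 e₁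
        (Matrix.diagonal (frameD V)) (complexConj_imagUnit (F : Type)) (imagUnit_ne_zero (F : Type)) (imagUnit_mul_self (F : Type))
        (realDiagonal_isSymm (F : Type) (frameD V) (frameD_real V)) (isUnit_det_realDiagonal (F : Type) (frameD V) (frameD_real V) (frameD_ne V))
        (realDiagonal_map (F : Type) (frameD V) (frameD_real V)).symm
        (hsChiD (⟨HodgeCM.CMField.K F⟩ : Summit.HodgeConjecture.CorCM.CMField) e₁ (frameD V) (frameD_real V) (frameD_ne V) κ hκu hκs) aU χ),
          θ (rhoVAtLine ↥(maximalRealSubfield (F : Type)) (F : Type) (IsCMField.complexConj (F : Type)) 3 e₁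
        (Matrix.diagonal (frameD V)) (complexConj_imagUnit (F : Type)) (imagUnit_ne_zero (F : Type)) (imagUnit_mul_self (F : Type))
        (realDiagonal_isSymm (F : Type) (frameD V) (frameD_real V)) (isUnit_det_realDiagonal (F : Type) (frameD V) (frameD_real V) (frameD_ne V))
        (realDiagonal_map (F : Type) (frameD V) (frameD_real V)).symm
        (hsChiD (⟨HodgeCM.CMField.K F⟩ : Summit.HodgeConjecture.CorCM.CMField) e₁ (frameD V) (frameD_real V) (frameD_ne V) κ hκu hκs) aU χ (ιVE V g) w) = rightRep F V g (θ w) := by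
  have hωf := distDatumAt_ωf V Φ σ a ha ha0 η hη hηc ν hν hνc A hV Φarch harm hdef
  obtain ⟨θ, h0, hhol, heq⟩ :=
    exists_holReal_of_transport_sideAt F V hV Φ σ a ha ha0 η hη hηc ν hν hνc A
      (distDatumAt V Φ σ a ha ha0 η hη hηc ν hν hνc A hV Φarch harm hdef) hLF hd hCR χM
      ((rhoVAtLine ↥(maximalRealSubfield (F : Type)) (F : Type) (IsCMField.complexConj (F : Type)) 3 e₁
        (Matrix.diagonal (frameD V)) (complexConj_imagUnit (F : Type)) (imagUnit_ne_zero (F : Type)) (imagUnit_mul_self (F : Type))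
        (realDiagonal_isSymm (F : Type) (frameD V) (frameD_real V)) (isUnit_det_realDiagonal (F : Type) (frameD V) (frameD_real V) (frameD_ne V))
        (realDiagonal_map (F : Type) (frameD V) (frameD_real V)).symm
        (hsChiD (⟨HodgeCM.CMField.K F⟩ : Summit.HodgeConjecture.CorCM.CMField) e₁ (frameD V) (frameD_real V) (frameD_ne V) κ hκu hκs) aU χ).comp (ιVE V))
      ((UnitaryDualPair.WeilCoinv.finPairRep _ _ _ _ _ _ _ _ _ _ _ _ _ _ _ _ _
          (splittingOf_isCompatible _ _ _ _ _ _ _ _ _ _ _ _ _ _ _ _ _ (compat_line₀ V Φ σ a ha ha0))).comp ((MonoidHom.inl _ _).comp (ιVE V)))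
      ((UnitaryDualPair.WeilCoinv.finPairRep _ _ _ _ _ _ _ _ _ _ _ _ _ _ _ _ _
          (splittingOf_isCompatible _ _ _ _ _ _ _ _ _ _ _ _ _ _ _ _ _ (compat_line₀ V Φ σ a ha ha0))).comp (MonoidHom.inr _ _))
      (fun g u => commute_comp_inl_comp_inr _ (ιVE V g) u) χ₁ lam Ψ (fun g x => hΨ g x)
      (finSBReindex (↥(maximalRealSubfield F)) e₁)
      (fun u => finCharZero V (cDiag Φ σ a ha ha0).D (compat_plane V Φ σ a ha ha0) (compat_line₀ V Φ σ a ha ha0) (compat_line₁ V Φ σ a ha ha0) (etaT₀ V (cDiag Φ σ a ha ha0).D η ν) (1, u))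
      (fun u v => by
        simp only [MonoidHom.coe_comp, Function.comp_apply, MonoidHom.inr_apply, hωf]
        exact finRepZero_inr_finSBReindex V (cDiag Φ σ a ha ha0).D (compat_plane V Φ σ a ha ha0) (compat_line₀ V Φ σ a ha ha0)
          (compat_line₁ V Φ σ a ha ha0) (etaT₀ V (cDiag Φ σ a ha ha0).D η ν) u v)
      (fun u => hχ u)
      (fun g v => by
        simp only [MonoidHom.coe_comp, Function.comp_apply, MonoidHom.inl_apply, hωf]
        refine (finRepZero_inl_finSBReindex V (cDiag Φ σ a ha ha0).D (compat_plane V Φ σ a ha ha0) (compat_line₀ V Φ σ a ha ha0)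
          (compat_line₁ V Φ σ a ha ha0) (etaT₀ V (cDiag Φ σ a ha ha0).D η ν) g v).trans ?_
        rw [hknob])
      hne
  exact ⟨θ, h0, hhol, fun g w => heq g w⟩

end Summit.HodgeConjecture.HodgeConjecture.Cruxes.H413.ThetaJunction

end
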